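import Mathlib
import Literature.NumberTheory.LFunctions.Zhang2022.SkeletonPartThree
import Literature.NumberTheory.LFunctions.Zhang2022.TypedAppendixB
import Literature.NumberTheory.LFunctions.ZetaOneLineBounds
import Literature.NumberTheory.LFunctions.ZetaFractionalPartIntegral

/-!
# Zhang (2022) Appendix B, proof of Lemma 15.1, `μ = 2`: bounds for `ζ(1+s)/ζ(1+s−β_j)` to the
# right of the imaginary axis (the tail estimates of the contour shift `StepB_u009rR`)

Topic `Literature/NumberTheory/LFunctions/Zhang2022` (Landau–Siegel audit tree; verdict-neutral).
Y. Zhang, *Discrete mean estimates and the Landau–Siegel zero*, arXiv:2211.02515v1 (2022)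
[Zhang2022LandauSiegel] — **an unrefereed manuscript under adjudication; nothing in this file
asserts any claim of the manuscript.** ZHANG-L discharge lane (WP15, App. B block B1 under the
leaf `Typed.Section15C.Eq15_22`), DAG node `Z22:§B.u009` [Z22 p.107, tex L5298] ("in a way
similar to the proof of Lemma 8.1"): the vertical line `Re s = 1` of
`intB2 = ζ(1+s)/ζ(1+s−β_j)·(P₂/l₁)ˢ/((log P₂)(s−β₇)²)` is moved to `Re s = ε = 1/log(P₂/l₁)`; the
tails `|t| ≥ t₀` of that line need `ζ(1+s)/ζ(1+s−β_j) = O(log⁸|t|)` uniformly in `0 < Re s ≤ 1`.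
This file PROVES that input from refereed, in-tree estimates (no new facts):

* `norm_zetaRatio_le_far` — for `0 < σ ≤ 1`, `|t| ≥ 5` (and `β_j` purely imaginary of modulus
  `≤ 1`): `‖ζ(1+σ+it)/ζ(1+σ+it−β_j)‖ ≤ 16K·log⁸|t|`, `K = 1134·16·336⁴`, from Titchmarsh's
  Theorem 3.5 (`ZetaOneLine.norm_riemannZeta_le_log`: `|ζ| ≤ 21 log|t|`) and (3.6.5)
  (`ZetaOneLine.norm_riemannZeta_ge_inv_log_pow_seven`: `|ζ| ≥ 168/(K log⁷|t|)` on `1 ≤ σ ≤ 2`);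
* `exists_norm_inv_riemannZeta_le_near` — `1/ζ` is bounded on the compact zero-free set
  `1 ≤ σ ≤ 2`, `t₀ ≤ |t| ≤ 6` (continuity + `riemannZeta_ne_zero_of_one_le_re`);
* `norm_riemannZeta_one_add_le_near` — `‖ζ(1+s)‖ ≤ 49/t₀` for `0 < Re s ≤ 1`, `t₀ ≤ |Im s| ≤ 5`
  (Titchmarsh (2.12.2), `norm_riemannZeta₁_le_of_re_pos`);
* `norm_zetaRatio_le_near` — the two combined: `‖ζ(1+s)/ζ(1+s−β_j)‖ ≤ 49M/t₀` there.

WHAT THIS IS NOT: the contour shift itself, Lemma 15.1, or any claim about Theorems 1–2 /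
Landau–Siegel zeros.

## References

* Y. Zhang, arXiv:2211.02515v1 (2022), App. B p. 107. [cite: Zhang2022LandauSiegel, App. B p.107]
* E. C. Titchmarsh, *The Theory of the Riemann Zeta-Function*, 2nd ed. (1986), Thm. 3.5, §3.6
  (3.6.5), §2.12 (2.12.2). [Titchmarsh1986]
-/

noncomputable section

open Complex Real Metric Set Filter Topology

namespace Literature.NumberTheory.LFunctions.Zhang2022.Skeleton

open Typed.AppendixB (zetaRatio)
open Literature.NumberTheory.LFunctions (norm_riemannZeta₁_le_of_re_pos)
open Literature.NumberTheory.LFunctions.ZetaOneLine (norm_riemannZeta_le_log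
  norm_riemannZeta_ge_inv_log_pow_seven log_abs_add_one_le)

section ZetaRatioBounds

variable (c' : ℝ)

/-- **Far range**: for `0 < σ ≤ 1`, `|t| ≥ 5`, and `β_j` purely imaginary with `|β_j| ≤ 1`,
`‖ζ(1+σ+it)/ζ(1+σ+it−β_j)‖ ≤ 16K log⁸|t|` with `K = 1134·16·336⁴` (Titchmarsh Thm. 3.5 for the
numerator, (3.6.5) for the denominator at height `|t − Im β_j| ≥ 4`, and `log(|t|+1) ≤ 2 log|t|`).
[cite: Titchmarsh1986, Thm. 3.5 and §3.6 (3.6.5)] -/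
theorem norm_zetaRatio_le_far (D j : ℕ) (hb1 : ‖betaJ c' D j‖ ≤ 1) (hbre : (betaJ c' D j).re = 0)
    {σ t : ℝ} (hσ0 : 0 < σ) (hσ1 : σ ≤ 1) (ht : 5 ≤ |t|) :
    ‖zetaRatio c' D j (σ + t * I)‖ ≤ 16 * (1134 * 16 * 336 ^ 4) * Real.log |t| ^ 8 := by
  set K : ℝ := 1134 * 16 * 336 ^ 4 with hKdef
  set b : ℂ := betaJ c' D j with hb
  have hK0 : 0 < K := by rw [hKdef]; norm_num
  -- the numerator
  have ht3 : 3 ≤ |t| := le_trans (by norm_num) ht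
  have ht2 : 2 ≤ |t| := le_trans (by norm_num) ht
  have hlog1 : 1 < Real.log |t| :=
    Literature.NumberTheory.LFunctions.MertensBound.one_lt_log_three.trans_le
      (Real.log_le_log (by norm_num) ht3)
  have hlog0 : 0 < Real.log |t| := lt_trans zero_lt_one hlog1
  have hsre : ((1 : ℂ) + (σ + t * I)).re = 1 + σ := by simp
  have hsim : ((1 : ℂ) + (σ + t * I)).im = t := by simp
  have hnum : ‖riemannZeta (1 + (σ + t * I))‖ ≤ 21 * Real.log |t| := by
    have h := norm_riemannZeta_le_log (s := 1 + (σ + t * I)) (by rw [hsim]; exact ht3)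
      (by rw [hsim, hsre]; linarith [show 0 < 1 / (2 * Real.log |t|) from by positivity])
    rwa [hsim] at h
  -- the denominator at `w = 1 + σ + it − b`
  set w : ℂ := 1 + (σ + t * I) - b with hw
  have hbim : |b.im| ≤ 1 := le_trans (Complex.abs_im_le_norm b) hb1
  have hwre : w.re = 1 + σ := by rw [hw]; simp [hbre]
  have hwim : w.im = t - b.im := by rw [hw]; simp
  have hwim4 : 4 ≤ |w.im| := by
    rw [hwim]
    have := abs_sub_abs_le_abs_sub t b.im
    linarith
  have hwim_le : |w.im| ≤ |t| + 1 := by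
    rw [hwim]
    calc |t - b.im| ≤ |t| + |b.im| := abs_sub _ _
      _ ≤ |t| + 1 := by linarith
  have hlogw0 : 0 < Real.log |w.im| := Real.log_pos (by linarith)
  have hlogw : Real.log |w.im| ≤ 2 * Real.log |t| :=
    le_trans (Real.log_le_log (by linarith) hwim_le) (log_abs_add_one_le ht2)
  have hden : 168 / (K * Real.log |w.im| ^ 7) ≤ ‖riemannZeta w‖ := by
    refine norm_riemannZeta_ge_inv_log_pow_seven (s := w) hwim4 ?_ (by rw [hwre]; linarith)
    rw [hwre]
    have : 0 < 1 / (2 * K * Real.log |w.im| ^ 9) := by positivity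
    linarith
  have hζw_pos : 0 < ‖riemannZeta w‖ := lt_of_lt_of_le (by positivity) hden
  have hinv : ‖(riemannZeta w)⁻¹‖ ≤ K * Real.log |w.im| ^ 7 / 168 := by
    rw [norm_inv, inv_le_comm₀ hζw_pos (by positivity)]
    calc (K * Real.log |w.im| ^ 7 / 168)⁻¹ = 168 / (K * Real.log |w.im| ^ 7) := by
          rw [inv_div]
      _ ≤ ‖riemannZeta w‖ := hden
  have hinv' : ‖(riemannZeta w)⁻¹‖ ≤ K * (2 * Real.log |t|) ^ 7 / 168 := by
    refine hinv.trans ?_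
    gcongr
  -- combine
  have hratio : zetaRatio c' D j (σ + t * I) = riemannZeta (1 + (σ + t * I)) * (riemannZeta w)⁻¹ := by
    rw [zetaRatio, div_eq_mul_inv]
  rw [hratio, norm_mul]
  calc ‖riemannZeta (1 + (σ + t * I))‖ * ‖(riemannZeta w)⁻¹‖
      ≤ (21 * Real.log |t|) * (K * (2 * Real.log |t|) ^ 7 / 168) :=
        mul_le_mul hnum hinv' (norm_nonneg _) (by positivity)
    _ = 16 * K * Real.log |t| ^ 8 := by ring

/-- **Near range, denominator**: `1/ζ` is bounded on the compact zero-free set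
`{1 ≤ Re w ≤ 2, t₀ ≤ |Im w| ≤ 6}` (`t₀ > 0`). [cite: Titchmarsh1986, §3.6] -/
theorem exists_norm_inv_riemannZeta_le_near {t₀ : ℝ} (ht₀ : 0 < t₀) :
    ∃ M : ℝ, 0 ≤ M ∧ ∀ w : ℂ, 1 ≤ w.re → w.re ≤ 2 → t₀ ≤ |w.im| → |w.im| ≤ 6 →
      ‖(riemannZeta w)⁻¹‖ ≤ M := by
  set Kc : Set ℂ := Icc (1 : ℝ) 2 ×ℂ (Icc t₀ 6 ∪ Icc (-6) (-t₀)) with hKc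
  have hcomp : IsCompact Kc := isCompact_Icc.reProdIm (isCompact_Icc.union isCompact_Icc)
  have hmem : ∀ w : ℂ, w ∈ Kc ↔ (1 ≤ w.re ∧ w.re ≤ 2) ∧ (t₀ ≤ |w.im| ∧ |w.im| ≤ 6) := by
    intro w
    rw [hKc, mem_reProdIm, mem_Icc, mem_union, mem_Icc, mem_Icc]
    constructor
    · rintro ⟨h1, h2 | h2⟩
      · exact ⟨h1, by rw [abs_of_pos (by linarith)]; exact h2⟩
      · exact ⟨h1, by rw [abs_of_neg (by linarith)]; constructor <;> linarith⟩
    · rintro ⟨h1, h2, h3⟩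
      refine ⟨h1, ?_⟩
      rcases le_or_gt 0 w.im with h | h
      · left; rw [abs_of_nonneg h] at h2 h3; exact ⟨h2, h3⟩
      · right; rw [abs_of_neg h] at h2 h3; constructor <;> linarith
  have hcont : ContinuousOn (fun w : ℂ => (riemannZeta w)⁻¹) Kc := by
    intro w hw
    obtain ⟨⟨h1, -⟩, h3, -⟩ := (hmem w).mp hw
    have him : w.im ≠ 0 := by
      intro h; rw [h, abs_zero] at h3; linarith
    have hw1 : w ≠ 1 := by intro h; rw [h] at him; simp at him
    have hζ : riemannZeta w ≠ 0 := riemannZeta_ne_zero_of_one_le_re h1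
    exact ((differentiableAt_riemannZeta hw1).continuousAt.inv₀ hζ).continuousWithinAt
  obtain ⟨M, hM⟩ := hcomp.exists_bound_of_continuousOn hcont
  refine ⟨max M 0, le_max_right _ _, fun w h1 h2 h3 h4 => ?_⟩
  exact (hM w ((hmem w).mpr ⟨⟨h1, h2⟩, h3, h4⟩)).trans (le_max_left _ _)

/-- **Near range, numerator** (Titchmarsh (2.12.2)): for `0 < Re s ≤ 1` and `t₀ ≤ |Im s| ≤ 5`,
`‖ζ(1+s)‖ ≤ 49/t₀` (`ζ(1+s) = s⁻¹ζ₁(1+s)`, `‖ζ₁(1+s)‖ ≤ ‖1+s‖ + ‖1+s‖‖s‖/(1+Re s) ≤ 49`).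
[cite: Titchmarsh1986, §2.12 eq. (2.12.2)] -/
theorem norm_riemannZeta_one_add_le_near {t₀ : ℝ} (ht₀ : 0 < t₀) {s : ℂ} (hs0 : 0 < s.re)
    (hs1 : s.re ≤ 1) (ht : t₀ ≤ |s.im|) (ht5 : |s.im| ≤ 5) :
    ‖riemannZeta (1 + s)‖ ≤ 49 / t₀ := by
  have hs_ne : s ≠ 0 := by
    intro h; rw [h, Complex.zero_im, abs_zero] at ht; linarith
  have h1 : (1 : ℂ) + s ≠ 1 := fun h => hs_ne (by linear_combination h)
  have hre : 0 < ((1 : ℂ) + s).re := by simp; linarith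
  have hns : ‖s‖ ≤ 6 := by
    calc ‖s‖ ≤ |s.re| + |s.im| := Complex.norm_le_abs_re_add_abs_im s
      _ ≤ 1 + 5 := add_le_add (by rw [abs_of_pos hs0]; exact hs1) ht5
      _ = 6 := by norm_num
  have hn1s : ‖(1 : ℂ) + s‖ ≤ 7 := by
    calc ‖(1 : ℂ) + s‖ ≤ ‖(1 : ℂ)‖ + ‖s‖ := norm_add_le _ _
      _ ≤ 7 := by rw [norm_one]; linarith
  have hζ₁ : ‖riemannZeta₁ (1 + s)‖ ≤ 49 := by
    have h := norm_riemannZeta₁_le_of_re_pos hre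
    have hre1 : 1 ≤ ((1 : ℂ) + s).re := by simp; linarith
    calc ‖riemannZeta₁ (1 + s)‖ ≤ ‖(1 : ℂ) + s‖ + ‖(1 : ℂ) + s‖ * ‖1 + s - 1‖ / (1 + s).re := h
      _ ≤ 7 + 7 * 6 / 1 := by
          rw [show (1 : ℂ) + s - 1 = s by ring]
          have hdiv : ‖(1 : ℂ) + s‖ * ‖s‖ / (1 + s).re ≤ ‖(1 : ℂ) + s‖ * ‖s‖ / 1 :=
            div_le_div_of_nonneg_left (by positivity) one_pos hre1
          have : ‖(1 : ℂ) + s‖ * ‖s‖ ≤ 7 * 6 :=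
            mul_le_mul hn1s hns (norm_nonneg _) (by norm_num)
          linarith
      _ = 49 := by norm_num
  have hsn : t₀ ≤ ‖s‖ := le_trans ht (Complex.abs_im_le_norm s)
  rw [riemannZeta_eq_inv_sub_mul h1, show (1 : ℂ) + s - 1 = s by ring, norm_mul, norm_inv]
  rw [inv_mul_le_iff₀ (lt_of_lt_of_le ht₀ hsn)]
  calc ‖riemannZeta₁ (1 + s)‖ ≤ 49 := hζ₁
    _ = 49 / t₀ * t₀ := by field_simp
    _ ≤ 49 / t₀ * ‖s‖ := by gcongr
    _ = ‖s‖ * (49 / t₀) := by ring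

/-- **Near range, combined**: with `M` a bound for `1/ζ` on `{1 ≤ Re ≤ 2, t₀/2 ≤ |Im| ≤ 6}`, for
`0 < σ ≤ 1`, `t₀ ≤ |t| ≤ 5` and `β_j` purely imaginary with `|β_j| ≤ t₀/2`:
`‖ζ(1+σ+it)/ζ(1+σ+it−β_j)‖ ≤ (49/t₀)·M`. [cite: Titchmarsh1986, §2.12 and §3.6] -/
theorem norm_zetaRatio_le_near (D j : ℕ) {t₀ M : ℝ} (ht₀ : 0 < t₀) (ht₀2 : t₀ ≤ 2)
    (hM : ∀ w : ℂ, 1 ≤ w.re → w.re ≤ 2 → t₀ / 2 ≤ |w.im| → |w.im| ≤ 6 → ‖(riemannZeta w)⁻¹‖ ≤ M)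
    (hb : ‖betaJ c' D j‖ ≤ t₀ / 2) (hbre : (betaJ c' D j).re = 0)
    {σ t : ℝ} (hσ0 : 0 < σ) (hσ1 : σ ≤ 1) (ht : t₀ ≤ |t|) (ht5 : |t| ≤ 5) :
    ‖zetaRatio c' D j (σ + t * I)‖ ≤ 49 / t₀ * M := by
  set b : ℂ := betaJ c' D j with hbdef
  set w : ℂ := 1 + (σ + t * I) - b with hw
  have hbim : |b.im| ≤ t₀ / 2 := le_trans (Complex.abs_im_le_norm b) hb
  have hwre : w.re = 1 + σ := by rw [hw]; simp [hbre]
  have hwim : w.im = t - b.im := by rw [hw]; simp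
  have hw1 : t₀ / 2 ≤ |w.im| := by
    rw [hwim]; have := abs_sub_abs_le_abs_sub t b.im; linarith
  have hw2 : |w.im| ≤ 6 := by
    rw [hwim]
    calc |t - b.im| ≤ |t| + |b.im| := abs_sub _ _
      _ ≤ 6 := by linarith [hbim, ht5, ht₀2]
  have hinv := hM w (by rw [hwre]; linarith) (by rw [hwre]; linarith) hw1 hw2
  have hnum := norm_riemannZeta_one_add_le_near ht₀ (s := σ + t * I) (by simpa using hσ0)
    (by simpa using hσ1) (by simpa using ht) (by simpa using ht5)
  have hratio : zetaRatio c' D j (σ + t * I) = riemannZeta (1 + (σ + t * I)) * (riemannZeta w)⁻¹ := by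
    rw [zetaRatio, div_eq_mul_inv]
  rw [hratio, norm_mul]
  exact mul_le_mul hnum hinv (norm_nonneg _) (by positivity)

end ZetaRatioBounds

end Literature.NumberTheory.LFunctions.Zhang2022.Skeleton
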